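import Literature.MathematicalPhysics.QuantumLattice.FockRelabel
import Literature.MathematicalPhysics.QuantumLattice.SiteBijectionSectorTransport

/-!
# Transport of sector ground-state data along site bijections (crux `NodalDiracWeakCoupling`, line `birth`)

Route `HubbardSuperconductivity/NodalDiracTwist`, crux stmt-HubbardSuperconductivity-10370, skeleton
`Cruxes/NodalDiracWeakCoupling/Lines/birth.lean` v6 (the `D₄` reshape). Generic lemmas, for any
site bijection `f : Λ ≃ Λ'` second-quantised as the signed permutation `relabelVec (Orb.mapEquiv f)`
of Fock vectors (`Literature…ProjectedBCSStateReal` / `HubbardRectangularTorus`) with conjugation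
action `relabel (Orb.mapEquiv f)` on matrices (`Literature…FermionRelabelling`):

* `isGroundStateInSector_of_relabelVec` — pull-back of sector ground states (the converse of the
  tree's `IsGroundStateInSector.relabelVec`);
* `deg_relabel_iff` — the degeneracy predicate "the `(N, S^z = M)` sector ground state admits an
  orthogonal pair" is invariant under `H ↦ Γ H Γ⁻¹`;
* `twofold_relabel` — an exactly two-dimensional sector ground space is transported;
* `cone_transport` — for a family `H(φ)`, `φ ∈ ℝ²`, covariant under `Γ` with respect to an
  involutive isometry `T` of the parameter plane (`Γ H(φ) Γ⁻¹ = H(T φ)`), the cone inequality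
  "every unit sector vector orthogonal to a ground state at `φ`, `0 < |φ - p| ≤ ρ`, has energy
  `≥ minEnergyOn + m |φ - p|`" about `p` implies the same about `T p`;
* bookkeeping: `relabel_perm_mul`, `relabelVec_add`, `twist_vec2_eta`.

All sorry-free; used by the skeleton's reduction `conicalQuartet_of_core`.

## References

O. Bratteli, D. W. Robinson, *Operator Algebras and Quantum Statistical Mechanics II* (1997),
§5.2.2, Thm. 5.2.5 (one-particle bijections are unitarily implemented on Fock space).
-/

-- the mandated namespace repeats `HubbardSuperconductivity` (single-problem summit, D-0017)
set_option linter.dupNamespace false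

noncomputable section

namespace Summit.HubbardSuperconductivity.HubbardSuperconductivity.Theorems.NodalDiracTwist

open Literature.MathematicalPhysics.QuantumLattice Matrix

/-- `relabel` along a product of permutations is the composite of the `relabel`s. [folklore] -/
theorem relabel_perm_mul {ι : Type*} [LinearOrder ι] [Fintype ι] (σ τ : Equiv.Perm ι)
    (A : Matrix (Finset ι) (Finset ι) ℂ) : relabel (σ * τ) A = relabel σ (relabel τ A) := by
  rw [Equiv.Perm.mul_def, relabel_trans]

/-- `φ = (φ₀, φ₁)` as a `Fin 2`-vector. [folklore] -/
theorem twist_vec2_eta (φ : Fin 2 → ℝ) : ![φ 0, φ 1] = φ := by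
  funext i
  fin_cases i <;> rfl

section Transport

variable {Λ Λ' : Type*} [LinearOrder Λ] [Fintype Λ] [LinearOrder Λ'] [Fintype Λ']

omit [Fintype Λ] [Fintype Λ'] in
/-- `Γ_e` is additive. [folklore] -/
theorem relabelVec_add (e : Orb Λ ≃ Orb Λ') (ψ χ : Fock (Orb Λ)) :
    relabelVec e (ψ + χ) = relabelVec e ψ + relabelVec e χ := by
  funext t
  simp only [relabelVec, Pi.add_apply, mul_add]

/-- **Pull-back of sector ground states**: if `Γ_f ψ` is a ground state of `Γ_f H Γ_f⁻¹` in the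
sector `(N, S^z = M)`, then `ψ` is one of `H` (converse of `IsGroundStateInSector.relabelVec`).
[cite: BratteliRobinsonII1997, §5.2.2, Thm. 5.2.5] -/
theorem isGroundStateInSector_of_relabelVec (f : Λ ≃ Λ')
    {H : Matrix (Finset (Orb Λ)) (Finset (Orb Λ)) ℂ} {N : ℕ} {M : ℝ} {ψ : Fock (Orb Λ)}
    (h : IsGroundStateInSector (relabel (Orb.mapEquiv f) H) N M (relabelVec (Orb.mapEquiv f) ψ)) :
    IsGroundStateInSector H N M ψ := by
  obtain ⟨hmem, hne, heig⟩ := h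
  refine ⟨mem_szSector_of_relabelVec_mem f hmem, fun h0 => hne (by rw [h0, relabelVec_zero]), ?_⟩
  apply relabelVec_injective (Orb.mapEquiv f)
  rw [← relabel_mulVec_relabelVec, heig, relabelVec_smul, minEnergyOn_relabel_szSector]

/-- **The degeneracy predicate is invariant under relabelling**: `Γ_f H Γ_f⁻¹` has an orthogonal
pair of `(N, S^z = M)`-sector ground states iff `H` has. [folklore] -/
theorem deg_relabel_iff (f : Λ ≃ Λ') (H : Matrix (Finset (Orb Λ)) (Finset (Orb Λ)) ℂ) (N : ℕ)
    (M : ℝ) :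
    (∃ ψ₁ ψ₂ : Fock (Orb Λ'),
        IsGroundStateInSector (relabel (Orb.mapEquiv f) H) N M ψ₁ ∧
        IsGroundStateInSector (relabel (Orb.mapEquiv f) H) N M ψ₂ ∧ star ψ₁ ⬝ᵥ ψ₂ = 0) ↔
    (∃ ψ₁ ψ₂ : Fock (Orb Λ),
        IsGroundStateInSector H N M ψ₁ ∧ IsGroundStateInSector H N M ψ₂ ∧ star ψ₁ ⬝ᵥ ψ₂ = 0) := by
  constructor
  · rintro ⟨χ₁, χ₂, h₁, h₂, h12⟩
    refine ⟨relabelVecInv (Orb.mapEquiv f) χ₁, relabelVecInv (Orb.mapEquiv f) χ₂, ?_, ?_, ?_⟩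
    · exact isGroundStateInSector_of_relabelVec f (by rwa [relabelVec_relabelVecInv])
    · exact isGroundStateInSector_of_relabelVec f (by rwa [relabelVec_relabelVecInv])
    · rw [← star_relabelVec_dotProduct (Orb.mapEquiv f), relabelVec_relabelVecInv,
        relabelVec_relabelVecInv, h12]
  · rintro ⟨ψ₁, ψ₂, h₁, h₂, h12⟩
    exact ⟨_, _, h₁.relabelVec f, h₂.relabelVec f, by rw [star_relabelVec_dotProduct, h12]⟩

/-- **Transport of an exactly two-fold sector ground space** along `Γ_f`: an orthogonal pair of
sector ground states spanning all sector ground states of `H` goes to such a pair for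
`Γ_f H Γ_f⁻¹`. [folklore] -/
theorem twofold_relabel (f : Λ ≃ Λ') {H : Matrix (Finset (Orb Λ)) (Finset (Orb Λ)) ℂ} {N : ℕ}
    {M : ℝ}
    (h : ∃ ψ₁ ψ₂ : Fock (Orb Λ),
        IsGroundStateInSector H N M ψ₁ ∧ IsGroundStateInSector H N M ψ₂ ∧ star ψ₁ ⬝ᵥ ψ₂ = 0 ∧
        ∀ χ : Fock (Orb Λ), IsGroundStateInSector H N M χ → ∃ z₁ z₂ : ℂ, χ = z₁ • ψ₁ + z₂ • ψ₂) :
    ∃ ψ₁ ψ₂ : Fock (Orb Λ'),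
        IsGroundStateInSector (relabel (Orb.mapEquiv f) H) N M ψ₁ ∧
        IsGroundStateInSector (relabel (Orb.mapEquiv f) H) N M ψ₂ ∧ star ψ₁ ⬝ᵥ ψ₂ = 0 ∧
        ∀ χ : Fock (Orb Λ'), IsGroundStateInSector (relabel (Orb.mapEquiv f) H) N M χ →
          ∃ z₁ z₂ : ℂ, χ = z₁ • ψ₁ + z₂ • ψ₂ := by
  obtain ⟨ψ₁, ψ₂, h₁, h₂, h12, hspan⟩ := h
  refine ⟨relabelVec (Orb.mapEquiv f) ψ₁, relabelVec (Orb.mapEquiv f) ψ₂, h₁.relabelVec f,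
    h₂.relabelVec f, by rw [star_relabelVec_dotProduct, h12], fun χ hχ => ?_⟩
  obtain ⟨z₁, z₂, hz⟩ := hspan (relabelVecInv (Orb.mapEquiv f) χ)
    (isGroundStateInSector_of_relabelVec f (by rwa [relabelVec_relabelVecInv]))
  refine ⟨z₁, z₂, ?_⟩
  rw [← relabelVec_relabelVecInv (Orb.mapEquiv f) χ, hz, relabelVec_add, relabelVec_smul,
    relabelVec_smul]


end Transport

/-- **Transport of the cone inequality.** Let `H(φ)` be a family of matrices on `Fock (Orb Λ)`
indexed by twists `φ ∈ ℝ²`, covariant under the site permutation `f` with respect to an involutive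
isometry `T` of twist space: `Γ_f H(φ) Γ_f⁻¹ = H(T φ)`, `T ∘ T = id`, `|T φ - T p| = |φ - p|`. If the
cone inequality (every unit `(N, S^z = M)`-sector vector orthogonal to a sector ground state at
`φ`, `0 < |φ - p| ≤ ρ`, has energy `≥ minEnergyOn + m |φ - p|`) holds about `p`, then it holds about
`T p` with the same `m, ρ` (pull back along `Γ_f` to `T φ`, which is as far from `p` as `φ` is from
`T p`; `Γ_f` preserves the sector, orthogonality, norms, expectations and the sector energy).
[folklore] -/
theorem cone_transport {Λ : Type*} [LinearOrder Λ] [Fintype Λ] (f : Equiv.Perm Λ)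
    (H : (Fin 2 → ℝ) → Matrix (Finset (Orb Λ)) (Finset (Orb Λ)) ℂ)
    (T : (Fin 2 → ℝ) → (Fin 2 → ℝ)) (hT : ∀ φ, relabel (Orb.mapEquiv f) (H φ) = H (T φ))
    (hTT : ∀ φ, T (T φ) = φ)
    (hiso : ∀ φ p : Fin 2 → ℝ,
      (T φ 0 - T p 0) ^ 2 + (T φ 1 - T p 1) ^ 2 = (φ 0 - p 0) ^ 2 + (φ 1 - p 1) ^ 2)
    (N : ℕ) (M : ℝ) (p : Fin 2 → ℝ)
    (h : ∃ m : ℝ, 0 < m ∧ ∃ ρ : ℝ, 0 < ρ ∧ ∀ φ : Fin 2 → ℝ,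
        0 < (φ 0 - p 0) ^ 2 + (φ 1 - p 1) ^ 2 → (φ 0 - p 0) ^ 2 + (φ 1 - p 1) ^ 2 ≤ ρ ^ 2 →
        ∀ ψ χ : Fock (Orb Λ), IsGroundStateInSector (H φ) N M ψ → χ ∈ szSector N M →
          star ψ ⬝ᵥ χ = 0 → star χ ⬝ᵥ χ = 1 →
            (H φ).minEnergyOn (szSector N M) + m * Real.sqrt ((φ 0 - p 0) ^ 2 + (φ 1 - p 1) ^ 2) ≤
              (star χ ⬝ᵥ (H φ *ᵥ χ)).re) :
    ∃ m : ℝ, 0 < m ∧ ∃ ρ : ℝ, 0 < ρ ∧ ∀ φ : Fin 2 → ℝ,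
        0 < (φ 0 - T p 0) ^ 2 + (φ 1 - T p 1) ^ 2 → (φ 0 - T p 0) ^ 2 + (φ 1 - T p 1) ^ 2 ≤ ρ ^ 2 →
        ∀ ψ χ : Fock (Orb Λ), IsGroundStateInSector (H φ) N M ψ → χ ∈ szSector N M →
          star ψ ⬝ᵥ χ = 0 → star χ ⬝ᵥ χ = 1 →
            (H φ).minEnergyOn (szSector N M) + m * Real.sqrt ((φ 0 - T p 0) ^ 2 + (φ 1 - T p 1) ^ 2) ≤
              (star χ ⬝ᵥ (H φ *ᵥ χ)).re := by
  obtain ⟨m, hm, ρ, hρ, hc⟩ := h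
  refine ⟨m, hm, ρ, hρ, fun φ h0 hle ψ χ hψ hχ horth hunit => ?_⟩
  -- pull everything back along `Γ_f` to the twist `T φ`, which lies near `p`
  set e : Orb Λ ≃ Orb Λ := Orb.mapEquiv f with he
  have hφ : H φ = relabel e (H (T φ)) := by rw [he, hT, hTT]
  have hd : (T φ 0 - p 0) ^ 2 + (T φ 1 - p 1) ^ 2 = (φ 0 - T p 0) ^ 2 + (φ 1 - T p 1) ^ 2 := by
    have := hiso (T φ) p
    rw [hTT] at this
    exact this.symm
  have hψ₀ : IsGroundStateInSector (H (T φ)) N M (relabelVecInv e ψ) :=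
    isGroundStateInSector_of_relabelVec f (by rw [← he, relabelVec_relabelVecInv, ← hφ]; exact hψ)
  have hχ₀ : relabelVecInv e χ ∈ szSector N M :=
    mem_szSector_of_relabelVec_mem f (by rw [← he, relabelVec_relabelVecInv]; exact hχ)
  have horth₀ : star (relabelVecInv e ψ) ⬝ᵥ relabelVecInv e χ = 0 := by
    rw [← star_relabelVec_dotProduct e, relabelVec_relabelVecInv, relabelVec_relabelVecInv, horth]
  have hunit₀ : star (relabelVecInv e χ) ⬝ᵥ relabelVecInv e χ = 1 := by
    rw [← star_relabelVec_dotProduct e, relabelVec_relabelVecInv, hunit]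
  have key := hc (T φ) (by rw [hd]; exact h0) (by rw [hd]; exact hle) _ _ hψ₀ hχ₀ horth₀ hunit₀
  -- and read the inequality back at `φ`
  have hE : (H φ).minEnergyOn (szSector N M) = (H (T φ)).minEnergyOn (szSector N M) := by
    rw [hφ, he, minEnergyOn_relabel_szSector]
  have hform : star χ ⬝ᵥ (H φ *ᵥ χ) =
      star (relabelVecInv e χ) ⬝ᵥ (H (T φ) *ᵥ relabelVecInv e χ) := by
    conv_lhs => rw [← relabelVec_relabelVecInv e χ, hφ, relabel_mulVec_relabelVec,
      star_relabelVec_dotProduct]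
  rw [hE, hform, ← hd]
  exact key

end Summit.HubbardSuperconductivity.HubbardSuperconductivity.Theorems.NodalDiracTwist

end
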